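/-
Copyright (c) 2026 the pub-hodgecm-mathlib formalisation cell (harness21).  Prover seat hodgecm-mathlib-K2E1-p16 (g2), Track B «K2-LIT» ENGINE E1, h413 = `stmt-HodgeConjecture-24833`,
route `HCCMUnconditional`, R90-S8 «ContSpec-n½» #2∕#3 chain, T1 FILE 4 (S8 dealer R90-CS-plan (g3), S8-R132 (3)): THE MAASS–SELBERG INNER-PRODUCT FORMULA ON THE TUBE FOR PAIR
SECTIONS OF `U(2,1)` AT THE CM PAIR — ★ final′ with the invariances and ALL FOUR `K_U`-average data DISCHARGED (survivor `hdec′` only).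
-/
import Summits.HodgeConjecture.HodgeConjecture.Theorems.K2E1MaassSelbergCMThreeFinal                -- ★ (K2E4-p14) ED. 2 `maassSelberg_flatSectionU_cm_three_final'` (section-generic)
import Summits.HodgeConjecture.HodgeConjecture.Theorems.K2E1ChiMaassSelbergCrossBracketsCMThree     -- ★ p863103 (this seat) `xi_package_cross`; brings ★ p862940 adapters
import Summits.HodgeConjecture.HodgeConjecture.Theorems.K2E1ChiIntertwinedSectionU3               -- ★ p861904 (this seat) `isChiSectionPair_intertwinedCoeff_three`
import Summits.HodgeConjecture.HodgeConjecture.Theorems.K2E1ChiMaassSelbergCMTwo                   -- ★ (N = 2 TEMPLATE, K2E1-p16 g1) `reflectChar_posRealIdele`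
import HarnessLib

/-!
# h413 ∕ R90-S8 T1 FILE 4 — `K2E1ChiMaassSelbergTubeAssemblyCMThree`: THE MAASS–SELBERG INNER-PRODUCT FORMULA ON THE TUBE FOR `(χ₁, χ₂)`-PAIR SECTIONS OF `U(2,1)` AT THE CM PAIR

Cell `pub/hodgecm-mathlib`, crux H413 = `stmt-HodgeConjecture-24833`; S8 dealer R90-CS-plan (g3) S8-R132 (3); census `K2/K2E1-p16/g2/CENSUS-T1.md`.  THEOREMS ONLY (no `def`, no
`instance`, no notation, no named-fact hypothesis, no `sorry`); lane `--supports stmt-HodgeConjecture-24833 --as helper` (count-neutral).  The `N = 3` twin of ★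
`K2E1ChiMaassSelbergCMTwo.maassSelberg_chiSection_cm_two` (the `U(1,1)` χ-section road), for PAIR sections.

THE MATHEMATICS ([MoeglinWaldspurger1995, II.1.7, IV.2.3]; [Arthur1980TraceFormulaII, §4]; [Garrett2018, §11.3]).  ★ ED. 2 `maassSelberg_flatSectionU_cm_three_final'` is the Maass–Selberg
relation on the sub-tube `2 < Re z′ < Re z` for GENERIC continuous bounded left-`N(𝔸)`∕`B(L⁺)`-invariant coefficients `φ, φ′`, its section-specific inputs being the four `K_U`-AVERAGE DATA
`hΞ₁…hΞ₄` (+ the decay `hdec′`).  For a `(χ₁, χ₂)`-section `φ` and a `(χ₁′, χ₂)`-section `φ′` (★ `IsChiSectionPair`, SHARED unitary automorphic middle character `χ₂`; `χ₁, χ₁′` unitary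
and ray-normalised `χ(ρ(r)) = 1`) these data are EXPLICIT: the intertwined coefficients `φ̃ = (∫_N f_z(w₀v·) dν)·H^{z−2}`, `φ̃′` are `(χ₁ʷ, χ₂)`-, `(χ₁′ʷ, χ₂)`-sections (★ p861904,
`χʷ = reflectChar c χ`), and for any `(α, χ₂)`-section `Φ`, `(β, χ₂)`-section `Ψ` the torus average is `∫_K Φ(tk) conj Ψ(tk) = α(t₀₀)·conj β(t₀₀)·⟨Φ, Ψ⟩_K` (★ p863103), so
`Ξ = α·conj β·⟨Φ, Ψ⟩_K` — measurable, bounded, `L^×`- and `ℝ_{>0}`-invariant (★ p863103 `xi_package_cross`).  HEAD **`maassSelberg_chiPair_cm_three`**: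
`⟨Λ^T E(φH^z), Λ^T E(φ′H^{z′})⟩_𝔛 = cμ·K·( T^{s₁}∕s₁·[χ₁·conj χ₁′·⟨φ,φ′⟩_K] + T^{s₂}∕s₂·[χ₁·conj χ₁′ʷ·⟨φ,φ̃′⟩_K] − T^{−s₂}∕s₂·[χ₁ʷ·conj χ₁′·⟨φ̃,φ′⟩_K] − T^{−s₁}∕s₁·[χ₁ʷ·conj χ₁′ʷ·⟨φ̃,φ̃′⟩_K] )`,
`s₁ = z + z̄′ − 2`, `s₂ = z − z̄′`, `[Ξ] = ∫_{{‖x‖≤1}∩𝓕_I} ‖x‖·Ξ x dν_I`, SURVIVOR `hdec′` ONLY (to be dropped by name once K2E2-p12 (g9)'s ED. 3 `…_final_free` is ★).  COROLLARY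
**`maassSelberg_chiPair_cm_three_self`** (`χ₁′ = χ₁`, `φ, φ′` sections of the SAME pair — the `‖Λ^T E‖²`-type pairing of the `hMStube` letter of ★ p862892): the outer densities are the
CONSTANTS `⟨φ,φ′⟩_K`, `⟨φ̃,φ̃′⟩_K` (brackets `κ·⟨·,·⟩_K`, `κ = ∫‖x‖`), the cross densities carry the idele class character `χ₁·conj χ₁ʷ` (bracket `= κ·⟨·,·⟩` iff `χ₁ʷ = χ₁` on norm-one
classes, else `0` — ★ `bracket_one`∕`bracket_character_eq_zero`, applied by the consumer): THIS is the two-variable three-scalar tube formula `R_χ₂(z, z′; a, w, B)` of ★ p862892 with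
`a = κ⟨φ,φ′⟩_K`, `conj (w z′) = [χ₁ conj χ₁ʷ·⟨φ,φ̃′_{z′}⟩_K]`, `w z = [χ₁ʷ conj χ₁·⟨φ̃_z,φ′⟩_K]`, `B z z′ = κ⟨φ̃_z,φ̃′_{z′}⟩_K`, on the genuine truncated series (the `L²`-family transfer
`hFtube` is K2E2-p12 (g9)'s (α′) tube operator road, junction bytes on the bus 23:5xZ).
HONEST LABEL: HC_CM is proved only modulo the 7 printed citations (2 remaining named inputs: hLiu418 = `stmt-HodgeConjecture-24832`, h413 = `stmt-HodgeConjecture-24833`) until rung 0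
closes; this file asserts no named fact and closes no socket; count-neutral; `hdec′` visible.

## References
* [MoeglinWaldspurger1995] C. Mœglin, J.-L. Waldspurger, *Spectral decomposition and Eisenstein series* (1995), II.1.7, IV.2.3.
* [Arthur1980TraceFormulaII] J. Arthur, *A trace formula for reductive groups II*, Compositio Math. 40 (1980), §4.
* [Garrett2018] P. Garrett, *Modern Analysis of Automorphic Forms by Example* (2018), §11.3.
-/

set_option autoImplicit false
-- the mandated namespace repeats `HodgeConjecture.HodgeConjecture`, as in every `Theorems/*.lean` of this sub-problem
set_option linter.dupNamespace false

noncomputable section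

open MeasureTheory Measure NumberField IsDedekindDomain Set
open scoped ENNReal NNReal ComplexConjugate
open Literature.MeasureTheory.Group Literature.NumberTheory
open Literature.NumberTheory.Automorphic Literature.NumberTheory.Automorphic.UnitaryGroup Literature.NumberTheory.GaloisRepresentations AdelicGroupData
open Literature.NumberTheory.Automorphic.Arthur2013.Leaves.TECR
open Summit.HodgeConjecture.HodgeConjecture.Cruxes.H413.K2E1BorelEisensteinU
open Summit.HodgeConjecture.HodgeConjecture.Cruxes.H413.K2E1CharacterEisensteinU2Defs
open Summit.HodgeConjecture.HodgeConjecture.Cruxes.H413.K2E1CharacterEisensteinU3PairDefs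
open Summit.HodgeConjecture.HodgeConjecture.Cruxes.H413.K2E1MaassSelbergCMThreeFinal (maassSelberg_flatSectionU_cm_three_final')
open Summit.HodgeConjecture.HodgeConjecture.Cruxes.H413.K2E1ChiIntertwinedSectionU3 (isChiSectionPair_intertwinedCoeff_three)
open Summit.HodgeConjecture.HodgeConjecture.Cruxes.H413.K2E1ChiMaassSelbergPairingsCMThree (chiPair_unipotentInBorel_mul chiPair_arithmeticBorel_mul)
open Summit.HodgeConjecture.HodgeConjecture.Cruxes.H413.K2E1ChiMaassSelbergCrossBracketsCMThree (xi_package_cross)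
open Summit.HodgeConjecture.HodgeConjecture.Cruxes.H413.K2E1ChiMaassSelbergCMTwo (reflectChar_posRealIdele)

namespace Summit.HodgeConjecture.HodgeConjecture.Cruxes.H413.K2E1ChiMaassSelbergTubeAssemblyCMThree

variable (L : Type) [Field L] [NumberField L] [IsCMField L]
variable [MeasurableSpace (quasiSplit (↥(maximalRealSubfield L)) L (IsCMField.complexConj L) 3).Adelic] [BorelSpace (quasiSplit (↥(maximalRealSubfield L)) L (IsCMField.complexConj L) 3).Adelic]
variable [MeasurableSpace (AdeleRing (𝓞 L) L)ˣ] [BorelSpace (AdeleRing (𝓞 L) L)ˣ]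

/-- **THE MAASS–SELBERG RELATION ON THE TUBE FOR PAIR SECTIONS OF `U(J₃)` AT THE CM PAIR** = ★ ED. 2 `maassSelberg_flatSectionU_cm_three_final′` for a continuous bounded
`(χ₁, χ₂)`-section `φ` and `(χ₁′, χ₂)`-section `φ′` (`χ₂` unitary automorphic, `χ₁, χ₁′` unitary ray-normalised) on `2 < Re z′ < Re z`: the invariances (★ p862940) and ALL FOUR
`K_U`-AVERAGE DATA (★ p863103 `xi_package_cross` on the pairs `(φ,φ′), (φ,φ̃′), (φ̃,φ′), (φ̃,φ̃′)`, ★ p861904 for `φ̃, φ̃′`) DISCHARGED, densities written inside the four idelic brackets;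
SURVIVOR `hdec′` ONLY. [cite: MoeglinWaldspurger1995, II.1.7 and IV.2.3] [cite: Arthur1980TraceFormulaII, §4] [cite: Garrett2018, §11.3] -/
theorem maassSelberg_chiPair_cm_three
    (μ : Measure (quasiSplit (↥(maximalRealSubfield L)) L (IsCMField.complexConj L) 3).automorphicQuotient) [(quasiSplit (↥(maximalRealSubfield L)) L (IsCMField.complexConj L) 3).IsAutomorphicMeasure μ]
    (νG : Measure (quasiSplit (↥(maximalRealSubfield L)) L (IsCMField.complexConj L) 3).Adelic) [νG.IsHaarMeasure] [νG.IsInvInvariant]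
    (μK : Measure ((standardMaximalCompactGL 3 L).comap (adelicVal (↥(maximalRealSubfield L)) L (IsCMField.complexConj L) 3 ((StdForm.antidiagonal 3).over L)) : Subgroup (quasiSplit (↥(maximalRealSubfield L)) L (IsCMField.complexConj L) 3).Adelic))
    [μK.IsHaarMeasure]
    (νI : Measure (AdeleRing (𝓞 L) L)ˣ) [νI.IsHaarMeasure]
    {𝓕I : Set (AdeleRing (𝓞 L) L)ˣ} (h𝓕I : IsIdeleClassDomain L 𝓕I)
    (ν : Measure ↥(adelicUnipotent (↥(maximalRealSubfield L)) L (IsCMField.complexConj L) 3)) [ν.IsHaarMeasure] [ν.IsInvInvariant]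
    {𝓕 : Set ↥(adelicUnipotent (↥(maximalRealSubfield L)) L (IsCMField.complexConj L) 3)} (h𝓕N : IsFundamentalDomain ↥(rationalUnipotent (↥(maximalRealSubfield L)) L (IsCMField.complexConj L) 3) 𝓕 ν) (h𝓕1 : ν 𝓕 = 1) (h𝓕c : IsCompact (closure 𝓕)) :
    ∃ cμ K : ℝ, 0 < cμ ∧ 0 < K ∧
      ∀ {β : (quasiSplit (↥(maximalRealSubfield L)) L (IsCMField.complexConj L) 3).Adelic → ℝ≥0∞}, IsCoveringWeight ((arithmeticBorel (↥(maximalRealSubfield L)) L (IsCMField.complexConj L) 3).map (quasiSplit (↥(maximalRealSubfield L)) L (IsCMField.complexConj L) 3).arithmeticSubgroup.subtype) β →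
      ∀ {T : ℝ≥0}, 1 ≤ T →
      ∀ {χ₁ χ₁' : HeckeCharacter L} {χ₂ : ↥(TorusDict.torus (IsCMField.complexConj L)) →ₜ* ℂˣ},
      χ₁.IsUnitary → (∀ r : ℝ≥0ˣ, χ₁ (posRealIdele L r) = 1) → χ₁'.IsUnitary → (∀ r : ℝ≥0ˣ, χ₁' (posRealIdele L r) = 1) →
      (∀ u, ‖((χ₂ u : ℂˣ) : ℂ)‖ = 1) → TorusDict.IsAutomorphic (IsCMField.complexConj L) χ₂ →
      ∀ {φ φ' : (quasiSplit (↥(maximalRealSubfield L)) L (IsCMField.complexConj L) 3).Adelic → ℂ},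
      Continuous φ → IsChiSectionPair χ₁ χ₂ φ → ∀ {Cφ : ℝ}, (∀ x, ‖φ x‖ ≤ Cφ) →
      Continuous φ' → IsChiSectionPair χ₁' χ₂ φ' → ∀ {Cφ' : ℝ}, (∀ x, ‖φ' x‖ ≤ Cφ') →
      ∀ {z z' : ℂ}, 2 < z'.re → z'.re < z.re →
      -- NAMED: the decay `hdec′` of `E(f′_{z′}) − E(f′_{z′})_B` on the Siegel region `{H > T}` — NOTHING ELSE (the invariances and ALL FOUR `K_U`-average data `hΞ₁…hΞ₄` are DISCHARGED: ★ p862940, ★ p863103, ★ p861904)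
        ∀ {M₁ : ℝ}, (∀ g : (quasiSplit (↥(maximalRealSubfield L)) L (IsCMField.complexConj L) 3).Adelic, T < borelHeight g →
          ‖eisensteinSeriesU (flatSectionU φ' z') g - borelConstantTerm ν 𝓕 (eisensteinSeriesU (flatSectionU φ' z')) g‖ ≤ M₁) →
        ∫ x, (quasiSplit (↥(maximalRealSubfield L)) L (IsCMField.complexConj L) 3).quotFun (truncation ν 𝓕 T (eisensteinSeriesU (flatSectionU φ z))) x * conj ((quasiSplit (↥(maximalRealSubfield L)) L (IsCMField.complexConj L) 3).quotFun (truncation ν 𝓕 T (eisensteinSeriesU (flatSectionU φ' z'))) x) ∂μ =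
          (cμ : ℂ) * ((K : ℂ) *
            ((((T : ℝ) : ℂ) ^ (z + conj z' - 2) / (z + conj z' - 2)) * (∫ x in {x : (AdeleRing (𝓞 L) L)ˣ | (IdeleClassGroup.ideleNorm L x : ℝ) ≤ 1} ∩ 𝓕I, ((IdeleClassGroup.ideleNorm L x : ℝ) : ℂ) * (((χ₁ x : ℂˣ) : ℂ) * conj ((χ₁' x : ℂˣ) : ℂ) * (∫ k, φ (k : (quasiSplit (↥(maximalRealSubfield L)) L (IsCMField.complexConj L) 3).Adelic) * conj (φ' (k : (quasiSplit (↥(maximalRealSubfield L)) L (IsCMField.complexConj L) 3).Adelic)) ∂μK)) ∂νI)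
              + (((T : ℝ) : ℂ) ^ (z - conj z') / (z - conj z')) * (∫ x in {x : (AdeleRing (𝓞 L) L)ˣ | (IdeleClassGroup.ideleNorm L x : ℝ) ≤ 1} ∩ 𝓕I, ((IdeleClassGroup.ideleNorm L x : ℝ) : ℂ) * (((χ₁ x : ℂˣ) : ℂ) * conj ((reflectChar (IsCMField.complexConj L) χ₁' x : ℂˣ) : ℂ) * (∫ k, φ (k : (quasiSplit (↥(maximalRealSubfield L)) L (IsCMField.complexConj L) 3).Adelic) * conj ((fun g : (quasiSplit (↥(maximalRealSubfield L)) L (IsCMField.complexConj L) 3).Adelic => (∫ v : ↥(adelicUnipotent (↥(maximalRealSubfield L)) L (IsCMField.complexConj L) 3), flatSectionU φ' z' ((quasiSplit (↥(maximalRealSubfield L)) L (IsCMField.complexConj L) 3).toAdelic (weylLongU ((IsCMField.complexConj L : L ≃ₐ[↥(maximalRealSubfield L)] L) : L →+* L) (rfl : (StdForm.antidiagonal 3).over L = (StdForm.antidiagonal 3).over L)) * ((v : (quasiSplit (↥(maximalRealSubfield L)) L (IsCMField.complexConj L) 3).Adelic) * g)) ∂ν) * ((borelHeight g : ℝ) :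 ℂ) ^ (z' - 2)) (k : (quasiSplit (↥(maximalRealSubfield L)) L (IsCMField.complexConj L) 3).Adelic)) ∂μK)) ∂νI)
              - (((T : ℝ) : ℂ) ^ (-(z - conj z')) / (z - conj z')) * (∫ x in {x : (AdeleRing (𝓞 L) L)ˣ | (IdeleClassGroup.ideleNorm L x : ℝ) ≤ 1} ∩ 𝓕I, ((IdeleClassGroup.ideleNorm L x : ℝ) : ℂ) * (((reflectChar (IsCMField.complexConj L) χ₁ x : ℂˣ) : ℂ) * conj ((χ₁' x : ℂˣ) : ℂ) * (∫ k, (fun g : (quasiSplit (↥(maximalRealSubfield L)) L (IsCMField.complexConj L) 3).Adelic => (∫ v : ↥(adelicUnipotent (↥(maximalRealSubfield L)) L (IsCMField.complexConj L) 3), flatSectionU φ z ((quasiSplit (↥(maximalRealSubfield L)) L (IsCMField.complexConj L) 3).toAdelic (weylLongU ((IsCMField.complexConj L : L ≃ₐ[↥(maximalRealSubfield L)] L) : L →+* L) (rfl : (StdForm.antidiagonal 3).over L = (StdForm.antidiagonal 3).over L)) * ((v : (quasiSplit (↥(maximalRealSubfield L)) L (IsCMField.complexConj L) 3).Adelic)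 * g)) ∂ν) * ((borelHeight g : ℝ) : ℂ) ^ (z - 2)) (k : (quasiSplit (↥(maximalRealSubfield L)) L (IsCMField.complexConj L) 3).Adelic) * conj (φ' (k : (quasiSplit (↥(maximalRealSubfield L)) L (IsCMField.complexConj L) 3).Adelic)) ∂μK)) ∂νI)
              - (((T : ℝ) : ℂ) ^ (-(z + conj z' - 2)) / (z + conj z' - 2)) * (∫ x in {x : (AdeleRing (𝓞 L) L)ˣ | (IdeleClassGroup.ideleNorm L x : ℝ) ≤ 1} ∩ 𝓕I, ((IdeleClassGroup.ideleNorm L x : ℝ) : ℂ) * (((reflectChar (IsCMField.complexConj L) χ₁ x : ℂˣ) : ℂ) * conj ((reflectChar (IsCMField.complexConj L) χ₁' x : ℂˣ) : ℂ) * (∫ k, (fun g : (quasiSplit (↥(maximalRealSubfield L)) L (IsCMField.complexConj L) 3).Adelic => (∫ v : ↥(adelicUnipotent (↥(maximalRealSubfield L)) L (IsCMField.complexConj L) 3), flatSectionU φ z ((quasiSplit (↥(maximalRealSubfield L)) L (IsCMField.complexConj L) 3).toAdelic (weylLongU ((IsCMField.complexConj L : L ≃ₐ[↥(maximalRealSubfield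 L)] L) : L →+* L) (rfl : (StdForm.antidiagonal 3).over L = (StdForm.antidiagonal 3).over L)) * ((v : (quasiSplit (↥(maximalRealSubfield L)) L (IsCMField.complexConj L) 3).Adelic) * g)) ∂ν) * ((borelHeight g : ℝ) : ℂ) ^ (z - 2)) (k : (quasiSplit (↥(maximalRealSubfield L)) L (IsCMField.complexConj L) 3).Adelic) * conj ((fun g : (quasiSplit (↥(maximalRealSubfield L)) L (IsCMField.complexConj L) 3).Adelic => (∫ v : ↥(adelicUnipotent (↥(maximalRealSubfield L)) L (IsCMField.complexConj L) 3), flatSectionU φ' z' ((quasiSplit (↥(maximalRealSubfield L)) L (IsCMField.complexConj L) 3).toAdelic (weylLongU ((IsCMField.complexConj L : L ≃ₐ[↥(maximalRealSubfield L)] L) : L →+* L) (rfl : (StdForm.antidiagonal 3).over L = (StdForm.antidiagonal 3).over L)) * ((v : (quasiSplit (↥(maximalRealSubfield L)) L (IsCMField.complexConj L) 3).Adelic) * g)) ∂ν) * ((borelHeight g : ℝ) : ℂ) ^ (z' - 2)) (k : (quasiSplit (↥(maximalRealSubfield L)) L (IsCMField.complexConj L) 3).Adelic)) ∂μK)) ∂νI)))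 := by
  obtain ⟨cμ, K, hcμ, hK, h⟩ := maassSelberg_flatSectionU_cm_three_final' L μ νG μK νI h𝓕I ν h𝓕N h𝓕1 h𝓕c
  refine ⟨cμ, K, hcμ, hK, ?_⟩
  intro β hβ T hT χ₁ χ₁' χ₂ hχ₁ hρ₁ hχ₁' hρ₁' hχ₂u hχ₂ φ φ' hφc hφ Cφ hφC hφ'c hφ' Cφ' hφ'C z z' hz' hzz' M₁ hdec'
  have hc : IsCMField.complexConj L * IsCMField.complexConj L = 1 := AlgEquiv.ext fun x => IsCMField.complexConj_apply_apply L x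
  have hc1 : IsCMField.complexConj L ≠ 1 := IsCMField.complexConj_ne_one L
  -- the intertwined coefficients are `(χ₁ʷ, χ₂)`- ∕ `(χ₁′ʷ, χ₂)`-pair sections (★ p861904)
  have hφt := isChiSectionPair_intertwinedCoeff_three hc hc1 ν hφ hφc.measurable z
  have hφ't := isChiSectionPair_intertwinedCoeff_three hc hc1 ν hφ' hφ'c.measurable z'
  have hχ₁w : (reflectChar (IsCMField.complexConj L) χ₁).IsUnitary := IsUnitary.reflectChar hχ₁
  have hχ₁'w : (reflectChar (IsCMField.complexConj L) χ₁').IsUnitary := IsUnitary.reflectChar hχ₁'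
  have hρ₁w : ∀ r : ℝ≥0ˣ, reflectChar (IsCMField.complexConj L) χ₁ (posRealIdele L r) = 1 := reflectChar_posRealIdele hρ₁
  have hρ₁'w : ∀ r : ℝ≥0ˣ, reflectChar (IsCMField.complexConj L) χ₁' (posRealIdele L r) = 1 := reflectChar_posRealIdele hρ₁'
  -- the four `Ξ`-packages (★ p863103 `xi_package_cross`)
  have p₁ := xi_package_cross hφ hφ' hχ₁ hχ₁' hχ₂u hρ₁ hρ₁' ((standardMaximalCompactGL 3 L).comap (adelicVal (↥(maximalRealSubfield L)) L (IsCMField.complexConj L) 3 ((StdForm.antidiagonal 3).over L)) : Subgroup (quasiSplit (↥(maximalRealSubfield L)) L (IsCMField.complexConj L) 3).Adelic) μK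
  have p₂ := xi_package_cross hφ hφ't hχ₁ hχ₁'w hχ₂u hρ₁ hρ₁'w ((standardMaximalCompactGL 3 L).comap (adelicVal (↥(maximalRealSubfield L)) L (IsCMField.complexConj L) 3 ((StdForm.antidiagonal 3).over L)) : Subgroup (quasiSplit (↥(maximalRealSubfield L)) L (IsCMField.complexConj L) 3).Adelic) μK
  have p₃ := xi_package_cross hφt hφ' hχ₁w hχ₁' hχ₂u hρ₁w hρ₁' ((standardMaximalCompactGL 3 L).comap (adelicVal (↥(maximalRealSubfield L)) L (IsCMField.complexConj L) 3 ((StdForm.antidiagonal 3).over L)) : Subgroup (quasiSplit (↥(maximalRealSubfield L)) L (IsCMField.complexConj L) 3).Adelic) μK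
  have p₄ := xi_package_cross hφt hφ't hχ₁w hχ₁'w hχ₂u hρ₁w hρ₁'w ((standardMaximalCompactGL 3 L).comap (adelicVal (↥(maximalRealSubfield L)) L (IsCMField.complexConj L) 3 ((StdForm.antidiagonal 3).over L)) : Subgroup (quasiSplit (↥(maximalRealSubfield L)) L (IsCMField.complexConj L) 3).Adelic) μK
  exact h hβ hT hφc (chiPair_unipotentInBorel_mul hφ) (chiPair_arithmeticBorel_mul hφ hχ₂) hφC hφ'c (chiPair_unipotentInBorel_mul hφ') (chiPair_arithmeticBorel_mul hφ' hχ₂) hφ'C hz' hzz' hdec'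
    (Ξ₁ := fun x : (AdeleRing (𝓞 L) L)ˣ => ((χ₁ x : ℂˣ) : ℂ) * conj ((χ₁' x : ℂˣ) : ℂ) * (∫ k, φ (k : (quasiSplit (↥(maximalRealSubfield L)) L (IsCMField.complexConj L) 3).Adelic) * conj (φ' (k : (quasiSplit (↥(maximalRealSubfield L)) L (IsCMField.complexConj L) 3).Adelic)) ∂μK))
    (Ξ₂ := fun x : (AdeleRing (𝓞 L) L)ˣ => ((χ₁ x : ℂˣ) : ℂ) * conj ((reflectChar (IsCMField.complexConj L) χ₁' x : ℂˣ) : ℂ) * (∫ k, φ (k : (quasiSplit (↥(maximalRealSubfield L)) L (IsCMField.complexConj L) 3).Adelic) * conj ((fun g : (quasiSplit (↥(maximalRealSubfield L)) L (IsCMField.complexConj L) 3).Adelic => (∫ v : ↥(adelicUnipotent (↥(maximalRealSubfield L)) L (IsCMField.complexConj L) 3), flatSectionU φ' z' ((quasiSplit (↥(maximalRealSubfield L)) L (IsCMField.complexConj L) 3).toAdelic (weylLongU ((IsCMField.complexConj L : L ≃ₐ[↥(maximalRealSubfield L)] L) : L →+* L) (rfl : (StdForm.antidiagonal 3).over L =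 (StdForm.antidiagonal 3).over L)) * ((v : (quasiSplit (↥(maximalRealSubfield L)) L (IsCMField.complexConj L) 3).Adelic) * g)) ∂ν) * ((borelHeight g : ℝ) : ℂ) ^ (z' - 2)) (k : (quasiSplit (↥(maximalRealSubfield L)) L (IsCMField.complexConj L) 3).Adelic)) ∂μK))
    (Ξ₃ := fun x : (AdeleRing (𝓞 L) L)ˣ => ((reflectChar (IsCMField.complexConj L) χ₁ x : ℂˣ) : ℂ) * conj ((χ₁' x : ℂˣ) : ℂ) * (∫ k, (fun g : (quasiSplit (↥(maximalRealSubfield L)) L (IsCMField.complexConj L) 3).Adelic => (∫ v : ↥(adelicUnipotent (↥(maximalRealSubfield L)) L (IsCMField.complexConj L) 3), flatSectionU φ z ((quasiSplit (↥(maximalRealSubfield L)) L (IsCMField.complexConj L) 3).toAdelic (weylLongU ((IsCMField.complexConj L : L ≃ₐ[↥(maximalRealSubfield L)] L) : L →+* L) (rfl : (StdForm.antidiagonal 3).over L = (StdForm.antidiagonal 3).over L)) * ((v : (quasiSplit (↥(maximalRealSubfield L)) L (IsCMField.complexConj L) 3).Adelic) * g)) ∂ν) * ((borelHeight g : ℝ)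 : ℂ) ^ (z - 2)) (k : (quasiSplit (↥(maximalRealSubfield L)) L (IsCMField.complexConj L) 3).Adelic) * conj (φ' (k : (quasiSplit (↥(maximalRealSubfield L)) L (IsCMField.complexConj L) 3).Adelic)) ∂μK))
    (Ξ₄ := fun x : (AdeleRing (𝓞 L) L)ˣ => ((reflectChar (IsCMField.complexConj L) χ₁ x : ℂˣ) : ℂ) * conj ((reflectChar (IsCMField.complexConj L) χ₁' x : ℂˣ) : ℂ) * (∫ k, (fun g : (quasiSplit (↥(maximalRealSubfield L)) L (IsCMField.complexConj L) 3).Adelic => (∫ v : ↥(adelicUnipotent (↥(maximalRealSubfield L)) L (IsCMField.complexConj L) 3), flatSectionU φ z ((quasiSplit (↥(maximalRealSubfield L)) L (IsCMField.complexConj L) 3).toAdelic (weylLongU ((IsCMField.complexConj L : L ≃ₐ[↥(maximalRealSubfield L)] L) : L →+* L) (rfl : (StdForm.antidiagonal 3).over L = (StdForm.antidiagonal 3).over L)) * ((v : (quasiSplit (↥(maximalRealSubfield L)) L (IsCMField.complexConj L) 3).Adelic) * g)) ∂ν) * ((borelHeight g : ℝ) : ℂ) ^ (z - 2)) (k : (quasiSplit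 (↥(maximalRealSubfield L)) L (IsCMField.complexConj L) 3).Adelic) * conj ((fun g : (quasiSplit (↥(maximalRealSubfield L)) L (IsCMField.complexConj L) 3).Adelic => (∫ v : ↥(adelicUnipotent (↥(maximalRealSubfield L)) L (IsCMField.complexConj L) 3), flatSectionU φ' z' ((quasiSplit (↥(maximalRealSubfield L)) L (IsCMField.complexConj L) 3).toAdelic (weylLongU ((IsCMField.complexConj L : L ≃ₐ[↥(maximalRealSubfield L)] L) : L →+* L) (rfl : (StdForm.antidiagonal 3).over L = (StdForm.antidiagonal 3).over L)) * ((v : (quasiSplit (↥(maximalRealSubfield L)) L (IsCMField.complexConj L) 3).Adelic) * g)) ∂ν) * ((borelHeight g : ℝ) : ℂ) ^ (z' - 2)) (k : (quasiSplit (↥(maximalRealSubfield L)) L (IsCMField.complexConj L) 3).Adelic)) ∂μK))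
    p₁.1 p₁.2.1 p₁.2.2.1 p₁.2.2.2.1 p₁.2.2.2.2 p₂.1 p₂.2.1 p₂.2.2.1 p₂.2.2.2.1 p₂.2.2.2.2 p₃.1 p₃.2.1 p₃.2.2.1 p₃.2.2.2.1 p₃.2.2.2.2 p₄.1 p₄.2.1 p₄.2.2.1 p₄.2.2.2.1 p₄.2.2.2.2

/-- **COROLLARY — ONE PAIR (`χ₁′ = χ₁`): THE `‖Λ^T E‖²`-TYPE PAIRING OF THE `hMStube` LETTER OF ★ p862892.**  For two sections `φ, φ′` of the SAME pair the outer densities are the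
CONSTANTS `⟨φ,φ′⟩_K`, `⟨φ̃,φ̃′⟩_K` (`χ₁·χ̄₁ = 1 = χ₁ʷ·conj χ₁ʷ`), so brackets 1 and 4 are `κ·⟨φ,φ′⟩_K`, `κ·⟨φ̃_z,φ̃′_{z′}⟩_K` with `κ = ∫_{{‖x‖≤1}∩𝓕_I} ‖x‖ dν_I`; the cross brackets keep
the idele class character `χ₁·conj χ₁ʷ` (`= κ·⟨·,·⟩_K` if `χ₁ʷ = χ₁` on norm-one classes — SELF-ASSOCIATE —, `= 0` otherwise: ★ `bracket_one`∕`bracket_character_eq_zero`, applied by the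
consumer).  This is the two-variable three-scalar formula `R_χ₂(z, z′; a, w, B)` of ★ p862892 on the genuine truncated series: `a = κ⟨φ,φ′⟩_K`,
`conj (w z′)·T^{s₂}∕s₂`-term `= [χ₁ conj χ₁ʷ·⟨φ,φ̃′_{z′}⟩_K]`, `w z`-term `= [χ₁ʷ conj χ₁·⟨φ̃_z,φ′⟩_K]`, `B z z′ = κ⟨φ̃_z,φ̃′_{z′}⟩_K`.  Survivor `hdec′` only.
[cite: MoeglinWaldspurger1995, II.1.7 and IV.2.3] [cite: Arthur1980TraceFormulaII, §4] [cite: Garrett2018, §11.3] -/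
theorem maassSelberg_chiPair_cm_three_self
    (μ : Measure (quasiSplit (↥(maximalRealSubfield L)) L (IsCMField.complexConj L) 3).automorphicQuotient) [(quasiSplit (↥(maximalRealSubfield L)) L (IsCMField.complexConj L) 3).IsAutomorphicMeasure μ]
    (νG : Measure (quasiSplit (↥(maximalRealSubfield L)) L (IsCMField.complexConj L) 3).Adelic) [νG.IsHaarMeasure] [νG.IsInvInvariant]
    (μK : Measure ((standardMaximalCompactGL 3 L).comap (adelicVal (↥(maximalRealSubfield L)) L (IsCMField.complexConj L) 3 ((StdForm.antidiagonal 3).over L)) : Subgroup (quasiSplit (↥(maximalRealSubfield L)) L (IsCMField.complexConj L) 3).Adelic))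
    [μK.IsHaarMeasure]
    (νI : Measure (AdeleRing (𝓞 L) L)ˣ) [νI.IsHaarMeasure]
    {𝓕I : Set (AdeleRing (𝓞 L) L)ˣ} (h𝓕I : IsIdeleClassDomain L 𝓕I)
    (ν : Measure ↥(adelicUnipotent (↥(maximalRealSubfield L)) L (IsCMField.complexConj L) 3)) [ν.IsHaarMeasure] [ν.IsInvInvariant]
    {𝓕 : Set ↥(adelicUnipotent (↥(maximalRealSubfield L)) L (IsCMField.complexConj L) 3)} (h𝓕N : IsFundamentalDomain ↥(rationalUnipotent (↥(maximalRealSubfield L)) L (IsCMField.complexConj L) 3) 𝓕 ν) (h𝓕1 : ν 𝓕 = 1) (h𝓕c : IsCompact (closure 𝓕)) :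
    ∃ cμ K : ℝ, 0 < cμ ∧ 0 < K ∧
      ∀ {β : (quasiSplit (↥(maximalRealSubfield L)) L (IsCMField.complexConj L) 3).Adelic → ℝ≥0∞}, IsCoveringWeight ((arithmeticBorel (↥(maximalRealSubfield L)) L (IsCMField.complexConj L) 3).map (quasiSplit (↥(maximalRealSubfield L)) L (IsCMField.complexConj L) 3).arithmeticSubgroup.subtype) β →
      ∀ {T : ℝ≥0}, 1 ≤ T →
      ∀ {χ₁ : HeckeCharacter L} {χ₂ : ↥(TorusDict.torus (IsCMField.complexConj L)) →ₜ* ℂˣ},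
      χ₁.IsUnitary → (∀ r : ℝ≥0ˣ, χ₁ (posRealIdele L r) = 1) → (∀ u, ‖((χ₂ u : ℂˣ) : ℂ)‖ = 1) → TorusDict.IsAutomorphic (IsCMField.complexConj L) χ₂ →
      ∀ {φ φ' : (quasiSplit (↥(maximalRealSubfield L)) L (IsCMField.complexConj L) 3).Adelic → ℂ},
      Continuous φ → IsChiSectionPair χ₁ χ₂ φ → ∀ {Cφ : ℝ}, (∀ x, ‖φ x‖ ≤ Cφ) →
      Continuous φ' → IsChiSectionPair χ₁ χ₂ φ' → ∀ {Cφ' : ℝ}, (∀ x, ‖φ' x‖ ≤ Cφ') →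
      ∀ {z z' : ℂ}, 2 < z'.re → z'.re < z.re →
      -- NAMED: `hdec′` only; brackets 1 and 4 are `κ·⟨φ,φ′⟩_K`, `κ·⟨φ̃,φ̃′⟩_K` (`κ = ∫‖x‖`), the cross brackets carry the idele class character `χ₁·conj χ₁ʷ`
        ∀ {M₁ : ℝ}, (∀ g : (quasiSplit (↥(maximalRealSubfield L)) L (IsCMField.complexConj L) 3).Adelic, T < borelHeight g →
          ‖eisensteinSeriesU (flatSectionU φ' z') g - borelConstantTerm ν 𝓕 (eisensteinSeriesU (flatSectionU φ' z')) g‖ ≤ M₁) →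
        ∫ x, (quasiSplit (↥(maximalRealSubfield L)) L (IsCMField.complexConj L) 3).quotFun (truncation ν 𝓕 T (eisensteinSeriesU (flatSectionU φ z))) x * conj ((quasiSplit (↥(maximalRealSubfield L)) L (IsCMField.complexConj L) 3).quotFun (truncation ν 𝓕 T (eisensteinSeriesU (flatSectionU φ' z'))) x) ∂μ =
          (cμ : ℂ) * ((K : ℂ) *
            ((((T : ℝ) : ℂ) ^ (z + conj z' - 2) / (z + conj z' - 2)) * ((∫ x in {x : (AdeleRing (𝓞 L) L)ˣ | (IdeleClassGroup.ideleNorm L x : ℝ) ≤ 1} ∩ 𝓕I, ((IdeleClassGroup.ideleNorm L x : ℝ) : ℂ) ∂νI) * (∫ k, φ (k : (quasiSplit (↥(maximalRealSubfield L)) L (IsCMField.complexConj L) 3).Adelic) * conj (φ' (k : (quasiSplit (↥(maximalRealSubfield L)) L (IsCMField.complexConj L) 3).Adelic)) ∂μK))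
              + (((T : ℝ) : ℂ) ^ (z - conj z') / (z - conj z')) * (∫ x in {x : (AdeleRing (𝓞 L) L)ˣ | (IdeleClassGroup.ideleNorm L x : ℝ) ≤ 1} ∩ 𝓕I, ((IdeleClassGroup.ideleNorm L x : ℝ) : ℂ) * (((χ₁ x : ℂˣ) : ℂ) * conj ((reflectChar (IsCMField.complexConj L) χ₁ x : ℂˣ) : ℂ) * (∫ k, φ (k : (quasiSplit (↥(maximalRealSubfield L)) L (IsCMField.complexConj L) 3).Adelic) * conj ((fun g : (quasiSplit (↥(maximalRealSubfield L)) L (IsCMField.complexConj L) 3).Adelic => (∫ v : ↥(adelicUnipotent (↥(maximalRealSubfield L)) L (IsCMField.complexConj L) 3), flatSectionU φ' z' ((quasiSplit (↥(maximalRealSubfield L)) L (IsCMField.complexConj L) 3).toAdelic (weylLongU ((IsCMField.complexConj L : L ≃ₐ[↥(maximalRealSubfield L)] L) : L →+* L) (rfl : (StdForm.antidiagonal 3).over L = (StdForm.antidiagonal 3).over L)) * ((v : (quasiSplit (↥(maximalRealSubfield L)) L (IsCMField.complexConj L) 3).Adelic) * g)) ∂ν) * ((borelHeight g : ℝ) :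 ℂ) ^ (z' - 2)) (k : (quasiSplit (↥(maximalRealSubfield L)) L (IsCMField.complexConj L) 3).Adelic)) ∂μK)) ∂νI)
              - (((T : ℝ) : ℂ) ^ (-(z - conj z')) / (z - conj z')) * (∫ x in {x : (AdeleRing (𝓞 L) L)ˣ | (IdeleClassGroup.ideleNorm L x : ℝ) ≤ 1} ∩ 𝓕I, ((IdeleClassGroup.ideleNorm L x : ℝ) : ℂ) * (((reflectChar (IsCMField.complexConj L) χ₁ x : ℂˣ) : ℂ) * conj ((χ₁ x : ℂˣ) : ℂ) * (∫ k, (fun g : (quasiSplit (↥(maximalRealSubfield L)) L (IsCMField.complexConj L) 3).Adelic => (∫ v : ↥(adelicUnipotent (↥(maximalRealSubfield L)) L (IsCMField.complexConj L) 3), flatSectionU φ z ((quasiSplit (↥(maximalRealSubfield L)) L (IsCMField.complexConj L) 3).toAdelic (weylLongU ((IsCMField.complexConj L : L ≃ₐ[↥(maximalRealSubfield L)] L) : L →+* L) (rfl : (StdForm.antidiagonal 3).over L = (StdForm.antidiagonal 3).over L)) * ((v : (quasiSplit (↥(maximalRealSubfield L)) L (IsCMField.complexConj L) 3).Adelic)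 * g)) ∂ν) * ((borelHeight g : ℝ) : ℂ) ^ (z - 2)) (k : (quasiSplit (↥(maximalRealSubfield L)) L (IsCMField.complexConj L) 3).Adelic) * conj (φ' (k : (quasiSplit (↥(maximalRealSubfield L)) L (IsCMField.complexConj L) 3).Adelic)) ∂μK)) ∂νI)
              - (((T : ℝ) : ℂ) ^ (-(z + conj z' - 2)) / (z + conj z' - 2)) * ((∫ x in {x : (AdeleRing (𝓞 L) L)ˣ | (IdeleClassGroup.ideleNorm L x : ℝ) ≤ 1} ∩ 𝓕I, ((IdeleClassGroup.ideleNorm L x : ℝ) : ℂ) ∂νI) * (∫ k, (fun g : (quasiSplit (↥(maximalRealSubfield L)) L (IsCMField.complexConj L) 3).Adelic => (∫ v : ↥(adelicUnipotent (↥(maximalRealSubfield L)) L (IsCMField.complexConj L) 3), flatSectionU φ z ((quasiSplit (↥(maximalRealSubfield L)) L (IsCMField.complexConj L) 3).toAdelic (weylLongU ((IsCMField.complexConj L : L ≃ₐ[↥(maximalRealSubfield L)] L) : L →+* L) (rfl : (StdForm.antidiagonal 3).over L = (StdForm.antidiagonal 3).over L)) * ((v : (quasiSplit (↥(maximalRealSubfield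 L)) L (IsCMField.complexConj L) 3).Adelic) * g)) ∂ν) * ((borelHeight g : ℝ) : ℂ) ^ (z - 2)) (k : (quasiSplit (↥(maximalRealSubfield L)) L (IsCMField.complexConj L) 3).Adelic) * conj ((fun g : (quasiSplit (↥(maximalRealSubfield L)) L (IsCMField.complexConj L) 3).Adelic => (∫ v : ↥(adelicUnipotent (↥(maximalRealSubfield L)) L (IsCMField.complexConj L) 3), flatSectionU φ' z' ((quasiSplit (↥(maximalRealSubfield L)) L (IsCMField.complexConj L) 3).toAdelic (weylLongU ((IsCMField.complexConj L : L ≃ₐ[↥(maximalRealSubfield L)] L) : L →+* L) (rfl : (StdForm.antidiagonal 3).over L = (StdForm.antidiagonal 3).over L)) * ((v : (quasiSplit (↥(maximalRealSubfield L)) L (IsCMField.complexConj L) 3).Adelic) * g)) ∂ν) * ((borelHeight g : ℝ) : ℂ) ^ (z' - 2)) (k : (quasiSplit (↥(maximalRealSubfield L)) L (IsCMField.complexConj L) 3).Adelic)) ∂μK)))) := by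
  obtain ⟨cμ, K, hcμ, hK, h⟩ := maassSelberg_chiPair_cm_three L μ νG μK νI h𝓕I ν h𝓕N h𝓕1 h𝓕c
  refine ⟨cμ, K, hcμ, hK, ?_⟩
  intro β hβ T hT χ₁ χ₂ hχ₁ hρ₁ hχ₂u hχ₂ φ φ' hφc hφ Cφ hφC hφ'c hφ' Cφ' hφ'C z z' hz' hzz' M₁ hdec'
  have key := h hβ hT hχ₁ hρ₁ hχ₁ hρ₁ hχ₂u hχ₂ hφc hφ hφC hφ'c hφ' hφ'C hz' hzz' hdec'
  have h1 : ∀ x : (AdeleRing (𝓞 L) L)ˣ, ((χ₁ x : ℂˣ) : ℂ) * conj ((χ₁ x : ℂˣ) : ℂ) = 1 := fun x => by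
    rw [Complex.mul_conj, Complex.normSq_eq_norm_sq, hχ₁ x, one_pow, Complex.ofReal_one]
  have h4 : ∀ x : (AdeleRing (𝓞 L) L)ˣ, ((reflectChar (IsCMField.complexConj L) χ₁ x : ℂˣ) : ℂ) * conj ((reflectChar (IsCMField.complexConj L) χ₁ x : ℂˣ) : ℂ) = 1 := fun x => by
    rw [Complex.mul_conj, Complex.normSq_eq_norm_sq, IsUnitary.reflectChar hχ₁ x, one_pow, Complex.ofReal_one]
  simp only [h1, h4, one_mul, integral_mul_const] at key
  exact key

end Summit.HodgeConjecture.HodgeConjecture.Cruxes.H413.K2E1ChiMaassSelbergTubeAssemblyCMThree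

end
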